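import Summits.BirchSwinnertonDyer.BirchSwinnertonDyer.Theorems.ErratumRoadFiveEulerHalfGenusJetchevClassData
import Summits.BirchSwinnertonDyer.BirchSwinnertonDyer.Theorems.Rank1ResidualJetThm63LocalFacts
import Summits.BirchSwinnertonDyer.BirchSwinnertonDyer.Theorems.Rank1ResidualJetTransverseConj
import Summits.BirchSwinnertonDyer.BirchSwinnertonDyer.Theorems.Rank1ResidualJetStringentTransport
import HarnessLib

/-!
# Erratum road at five, Euler half — genus line: road K's [J] Thm 6.3 at a core vertex over CLASS
# DATA with every STRUCTURE-LEVEL parameter supplied (Weil datum, intrinsic transverse family,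
# stringent family with (δ), the two Poitou–Tate packages)

HONEST FRAMING: no summit statement is proved here and BSD is proved for no curve. THEOREMS ONLY
(ideator seat `bsd-idea-9`, D-0154 §B, lens = complete; `--supports stmt-BirchSwinnertonDyer-23444`,
helper for the `genus` line of `ErratumRoadFive`, crux `EulerHalfPOnlyMultPotMultTwinAtFive`, twin
(b2b) `GenusJetchevThm63` of the candidate `Lines/genus_turnkey_v18`).

WHAT THIS IS. The sibling file `ErratumRoadFiveEulerHalfGenusJetchevClassData` re-states road K's
`JET.tamagawaExponent_le_mInfty_of_rowData` over CLASS DATA (`κ_c`, `κ_{cℓ}` parameters) but keeps the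
row theorem's structure-level parameters (`𝒯`, `𝒮`, `Qcar`, `C'`, `hC`, `hdual_q`, `hdual_ℓ`). Road K
discharges those in four layers (`…_of_kernelInputs_duality` → `…_of_localInputs` →
`…_of_localInputs_stringent` → `…_of_localFacts`), each of which threads the Heegner frame through
ONLY because the classes are `KolyvaginHeegnerData.kolyvaginClass`. This file runs the same four
layers ONCE over class data, BY NAME: the Weil datum `JET.exists_weilDatum_liftAut`, the intrinsic
transverse family `JET.exists_localTransverseFamily`, the stringent family `JET.stringentFamily` with
`JET.stringentFamily_le_kummer` / `JET.isAddCyclic_kummer_quotient_stringentFamily` /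
`JET.relIndex_stringentFamily_eq_pow` ((δ)), the carrier pair `{v₀, τ v₀}` disjoint from the places of
`c` (`c` is prime to the conductor), and the two Poitou–Tate packages
`JET.GlobalDuality.exists_rowDuality_modified`; the Prop 4.9♯ membership of `κ_{cℓ}` in
`(H_{(𝓕₀)^λ(c)})^{−ε}` is assembled from its four local clauses by `JET.mem_signPart_relaxedAt_selmerF0`.
WHAT IS LEFT as hypotheses is exactly road K's `…_of_localFacts` list with the frame replaced by class
data: named print {`hPT` Poitou–Tate}; local print-to-type {`hloc` [J] Lemma 5.2 (i)(ii), `h𝒯sd`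
Howard 2004 Prop. 2.1.9 (ii)}; row data at the carrier place (the `τ`-stabilities `h𝒯σ` / `h𝒮σ` are
SUPPLIED by `JET.conjActPlace_mem_transverseFamily_forall` / `JET.conjActPlace_mem_stringentFamily`, as in
road K's `…_of_localFacts'`); and the CLASS DATA {S7 at `c`: `hκsel`, `hκsign`, `hκ0`, `hordκ`; at `cℓ`: sign `hκℓsign`, Kummer
off `cℓ` `hκℓkum`, stringent at the carrier `h49str`, transverse at `c` `h49tr` (Prop 4.9♯), and Prop 4.7
`h47`}. NO `SatisfiesHeegnerHypothesis`, NO `ModularParametrizationData`, NO `KolyvaginHeegnerData`, NO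
typed McCallum fact. CONCLUSION `ord_p c_{v₀}(W/K) ≤ m_∞`. USE: the genus twin (b2b) applies this
theorem at the split carrier place over `p` with the genus family's classes.
References: [cite: Jetchev2008, Thm. 5.2 (p. 821) = arXiv Thm. 6.3, Thm. 5.1, Lemma 5.2, Prop. 4.7,
Prop. 4.9, §3.1.2, §3.3.2] [cite: Howard2004HeegnerKolyvagin, Prop. 2.1.9, Thm. 2.1.11, Lemma 2.7.3]
[cite: McCallumLMS1991, §3 Cor. 3.2, §4 Prop. 4.4] [cite: GrossLMS1991, Prop. 5.4, Prop. 6.2 (1)]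
[cite: MilneADT2006, Ch. I, Thm. 4.10(b)] [cite: SilvermanAEC2009, Prop. III.8.1].
-/

set_option autoImplicit false
set_option linter.dupNamespace false

noncomputable section

open scoped Classical Pointwise

open WeierstrassCurve IsDedekindDomain NumberField Field Literature.NumberTheory.EllipticCurves
  Literature.NumberTheory.EllipticCurves.ModularForms Literature.NumberTheory.EllipticCurves.Jetchev2008
  Literature.NumberTheory.GaloisRepresentations Literature.NumberTheory.GaloisCohomology
  Literature.NumberTheory.GaloisRepresentations.DiscreteGaloisModule
  Summit.BirchSwinnertonDyer.Rank1Residual.X11b Summit.BirchSwinnertonDyer.Rank1Residual.X11b.Three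
  Summit.BirchSwinnertonDyer.Rank1Residual.JET.SelmerVocabulary Literature.NumberTheory.Automorphic
  Summit.BirchSwinnertonDyer.Rank1Residual

namespace Summit.BirchSwinnertonDyer.BirchSwinnertonDyer.Theorems.GenusKolyvagin.ClassData

/-- **[J] Thm 6.3 at a core vertex over CLASS DATA, every structure-level parameter supplied by tree
theorems** (road K's `JET.tamagawaExponent_le_mInfty_of_localFacts'` with the Heegner frame replaced by
class data and `h𝒯σ` supplied too; see the module docstring for the complete list of what remains). CONCLUSION:
`ord_p c_{v₀}(W/K) ≤ m_∞`. [cite: Jetchev2008, Thm. 5.2 (p. 821) and proof (pp. 821–823), Thm. 5.1,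
Lemma 5.2, Prop. 4.7, Prop. 4.9] [cite: Howard2004HeegnerKolyvagin, Prop. 2.1.9, Thm. 2.1.11]
[cite: McCallumLMS1991, §3 Cor. 3.2] [cite: MilneADT2006, Ch. I, Thm. 4.10(b)] -/
theorem tamagawaExponent_le_mInfty_of_classData_localFacts
    (W : WeierstrassCurve ℚ) [W.IsElliptic] [W.IsGloballyMinimal] [NeZero (W.conductorNorm ℤ)]
    (hcm : ¬ W.HasCM) (K : Type) [Field K] [NumberField K] (hK : IsImaginaryQuadratic K)
    (hPT : poitouTate_selmerStructure_duality_conj K)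
    (p : ℕ) [Fact p.Prime] (hp2 : p ≠ 2) (htower : ∀ n : ℕ, W.HasSurjectiveModNGaloisRep (p ^ n : ℕ))
    (ι : K →+* ℂ)
    [∀ j : ℕ, NumberField (ringClassField K ι j)]
    (τ : K ≃ₐ[ℚ] K) (hτ : τ ≠ 1) (hτ2 : τ * τ = 1)
    -- the sign `ε` of the class at `c` (the classes at `cℓ` carry `−ε`)
    (ε : ℤ) (hε : ε = 1 ∨ ε = -1)
    (k : ℕ) [NeZero (p ^ k)] [Finite (geomTorsion (W.baseChange K) ((p ^ k : ℕ) : ℤ))]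
    (hn : ((p ^ k : ℕ) : ℤ) ≠ 0)
    (c : ℕ) (hc : Squarefree c)
    (hcK : ∀ ℓ ∈ c.primeFactors, Zhang2014.IsKolyvaginPrime (W.conductorNorm ℤ) W K p ℓ ∧
      k ≤ Zhang2014.kolyvaginIndex W p ℓ) (hk : 1 ≤ k)
    (hcore : IsGlobalCoreVertex W K ι τ p k c) (mInf : ℕ) (hik : mInf < k)
    -- ROW DATA at the carrier place `v₀`
    (v₀ : HeightOneSpectrum (𝓞 K)) (hv₀ : τ • v₀ ≠ v₀)
    (hv₀N : ((W.conductorNorm ℤ : ℕ) : 𝓞 K) ∈ v₀.asIdeal)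
    [hmin : ((W.baseChange K).baseChange (v₀.adicCompletion K)).IsMinimal (v₀.adicCompletionIntegers K)]
    (hc0 : ((W.baseChange K).baseChange (v₀.adicCompletion K)).localTamagawaNumber
      (v₀.adicCompletionIntegers K) ≠ 0)
    [hΦ : IsAddCyclic (((W.baseChange K).baseChange (v₀.adicCompletion K)).toAffine.Point ⧸
      ((W.baseChange K).baseChange (v₀.adicCompletion K)).goodReductionSubgroup (v₀.adicCompletionIntegers K))]
    (htk : (((W.baseChange K).baseChange (v₀.adicCompletion K)).localTamagawaNumber
      (v₀.adicCompletionIntegers K)).factorization p < k)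
    -- LOCAL PRINT-TO-TYPE: the intrinsic transverse condition is Lagrangian (Howard 2.1.9 (ii))
    (h𝒯sd : ∀ (𝒯 : SelmerStructure ((W.baseChange K).torsionGaloisModule ((p ^ k : ℕ) : ℤ))),
      (∀ v : HeightOneSpectrum (𝓞 K), 𝒯 (Sum.inr v) =
        ⨅ ℓ ∈ c.primeFactors.filter (fun ℓ : ℕ ↦ ((ℓ : ℕ) : 𝓞 K) ∈ v.asIdeal),
          ⨅ (w' : HeightOneSpectrum (𝓞 (ringClassField K ι ℓ))) (_ : w'.asIdeal.LiesOver v.asIdeal),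
            letI := (adicCompletionOfLiesOver K (ringClassField K ι ℓ) v w').toAlgebra
            transverseSubgroup (GaloisRep.toLocal v ((W.baseChange K).torsionGaloisModule ((p ^ k : ℕ) : ℤ)))
              (w'.adicCompletion (ringClassField K ι ℓ))) →
      ∀ (e : geomTorsion (W.baseChange K) ((p ^ k : ℕ) : ℤ) →
          geomTorsion (W.baseChange K) ((p ^ k : ℕ) : ℤ) → AlgebraicClosure K)
        (hμ : ∀ S T, e S T ^ (p ^ k) = 1)
        (hadd₁ : ∀ S₁ S₂ T, e (S₁ + S₂) T = e S₁ T * e S₂ T)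
        (hadd₂ : ∀ S T₁ T₂, e S (T₁ + T₂) = e S T₁ * e S T₂)
        (hgal : ∀ (g : absoluteGaloisGroup K) (S T : geomTorsion (W.baseChange K) ((p ^ k : ℕ) : ℤ)),
          g • e S T = e (g • S) (g • T)),
      (∀ T, e T T = 1) → (∀ T, (∀ S, e S T = 1) → T = 0) →
      ∀ inv : LocalInvariants K (p ^ k), inv.IsPerfect → ∀ v ∈ placesDividing K c,
      inv.dualTransported 𝒯 (weilDualIntertwining (W.baseChange K) (p ^ k) e hμ hadd₁ hadd₂ hgal)
        (Sum.inr v) = 𝒯 (Sum.inr v))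
    -- LOCAL PRINT-TO-TYPE (Lemma 5.2 (i)–(ii)) at the Kolyvagin primes `λ ∤ c`
    (hloc : ∀ ℓ : ℕ, Zhang2014.IsKolyvaginPrime (W.conductorNorm ℤ) W K p ℓ →
      k ≤ Zhang2014.kolyvaginIndex W p ℓ → ℓ ∉ c.primeFactors →
      ∀ (v : HeightOneSpectrum (𝓞 K)), (ℓ : 𝓞 K) ∈ v.asIdeal → ∀ (hfix : τ • v = v)
        (s : ℤ), s = 1 ∨ s = -1 →
      ((W.baseChange K).kummerSelmerStructure ((p ^ k : ℕ) : ℤ) (Sum.inr v)).relIndex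
        ((conjActPlace W τ ((p ^ k : ℕ) : ℤ) hfix - s • AddMonoidHom.id _).ker) = p ^ k)
    -- KERNEL GAPS (completion layer)
    -- CLASS DATA at `c` ([J] S7): `κ ∈ H_{𝓕(c)}`, `τκ = eκ`, `κ ≠ 0`, `ord κ = p^{k − m_∞}`
    (κ : galH1Torsion (W.baseChange K) ((p ^ k : ℕ) : ℤ))
    (hκsel : κ ∈ modifiedSelmerGroup W K ι ((p ^ k : ℕ) : ℤ) c)
    (hκsign : conjAct W τ ((p ^ k : ℕ) : ℤ) κ = ε • κ) (hκ0 : κ ≠ 0)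
    (hordκ : addOrderOf κ = p ^ (k - mInf))
    -- CLASS DATA at `cℓ`, `ℓ ∤ c` Kolyvagin with `k ≤ M(ℓ)`: the sign `−e` (Gross 5.4-type) and the
    -- Kummer condition at every place not over `cℓ` (Gross 6.2 (1)-type)
    (κℓ : ∀ ℓ : ℕ, Zhang2014.IsKolyvaginPrime (W.conductorNorm ℤ) W K p ℓ →
      k ≤ Zhang2014.kolyvaginIndex W p ℓ → ℓ ∉ c.primeFactors →
      galH1Torsion (W.baseChange K) ((p ^ k : ℕ) : ℤ))
    (hκℓsign : ∀ (ℓ : ℕ) (h1 : Zhang2014.IsKolyvaginPrime (W.conductorNorm ℤ) W K p ℓ)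
      (h2 : k ≤ Zhang2014.kolyvaginIndex W p ℓ) (h3 : ℓ ∉ c.primeFactors),
      conjAct W τ ((p ^ k : ℕ) : ℤ) (κℓ ℓ h1 h2 h3) = (-ε) • κℓ ℓ h1 h2 h3)
    (hκℓkum : ∀ (ℓ : ℕ) (h1 : Zhang2014.IsKolyvaginPrime (W.conductorNorm ℤ) W K p ℓ)
      (h2 : k ≤ Zhang2014.kolyvaginIndex W p ℓ) (h3 : ℓ ∉ c.primeFactors) (w : Place K),
      (∀ l' ∈ (c * ℓ).primeFactors, ¬ PlaceOver K w l') →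
      galoisCohomology.localization ((W.baseChange K).torsionGaloisModule ((p ^ k : ℕ) : ℤ)) w 1
          (κℓ ℓ h1 h2 h3) ∈ (W.baseChange K).kummerSelmerStructure ((p ^ k : ℕ) : ℤ) w)
    -- CLASS DATA at `cℓ` ([J] Prop 4.9♯): stringent at the carrier pair, transverse at the primes of `c`
    (h49str : ∀ (ℓ : ℕ) (h1 : Zhang2014.IsKolyvaginPrime (W.conductorNorm ℤ) W K p ℓ)
      (h2 : k ≤ Zhang2014.kolyvaginIndex W p ℓ) (h3 : ℓ ∉ c.primeFactors),
      ∀ q ∈ ({v₀, τ • v₀} : Finset _),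
      galoisCohomology.localization ((W.baseChange K).torsionGaloisModule ((p ^ k : ℕ) : ℤ))
          (Sum.inr q) 1 (κℓ ℓ h1 h2 h3) ∈ JET.stringentFamily W K hn (Sum.inr q))
    (h49tr : ∀ (ℓ : ℕ) (h1 : Zhang2014.IsKolyvaginPrime (W.conductorNorm ℤ) W K p ℓ)
      (h2 : k ≤ Zhang2014.kolyvaginIndex W p ℓ) (h3 : ℓ ∉ c.primeFactors),
      ∀ w ∈ placesDividing K c,
      galoisCohomology.localization ((W.baseChange K).torsionGaloisModule ((p ^ k : ℕ) : ℤ))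
          (Sum.inr w) 1 (κℓ ℓ h1 h2 h3) ∈
        ⨅ ℓ' ∈ c.primeFactors.filter (fun ℓ' : ℕ ↦ ((ℓ' : ℕ) : 𝓞 K) ∈ w.asIdeal),
          ⨅ (w' : HeightOneSpectrum (𝓞 (ringClassField K ι ℓ'))) (_ : w'.asIdeal.LiesOver w.asIdeal),
            letI := (adicCompletionOfLiesOver K (ringClassField K ι ℓ') w w').toAlgebra
            transverseSubgroup (GaloisRep.toLocal w ((W.baseChange K).torsionGaloisModule ((p ^ k : ℕ) : ℤ)))
              (w'.adicCompletion (ringClassField K ι ℓ')))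
    -- CLASS DATA at `cℓ` ([J] Prop 4.7 ⟸ [McC] Prop 4.4-type): `ord loc_λ κ_{cℓ} = ord loc_λ κ_c`
    (h47 : ∀ (ℓ : ℕ) (h1 : Zhang2014.IsKolyvaginPrime (W.conductorNorm ℤ) W K p ℓ)
      (h2 : k ≤ Zhang2014.kolyvaginIndex W p ℓ) (h3 : ℓ ∉ c.primeFactors)
      (v : HeightOneSpectrum (𝓞 K)), (ℓ : 𝓞 K) ∈ v.asIdeal →
      addOrderOf (galoisCohomology.localization ((W.baseChange K).torsionGaloisModule ((p ^ k : ℕ) : ℤ))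
        (Sum.inr v) 1 (κℓ ℓ h1 h2 h3)) =
      addOrderOf (galoisCohomology.localization ((W.baseChange K).torsionGaloisModule ((p ^ k : ℕ) : ℤ))
        (Sum.inr v) 1 κ)) :
    (((W.baseChange K).baseChange (v₀.adicCompletion K)).localTamagawaNumber

      (v₀.adicCompletionIntegers K)).factorization p ≤ mInf := by
  have hp : p.Prime := Fact.out
  have hc0' : c ≠ 0 := hc.ne_zero
  -- the Weil datum (theorem)
  have h2 : 2 ≤ p ^ k := by
    calc 2 ≤ p := hp.two_le
      _ = p ^ 1 := (pow_one p).symm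
      _ ≤ p ^ k := Nat.pow_le_pow_right hp.pos hk
  obtain ⟨wp, hμ, hadd₁, hadd₂, hgal, halt, hnondeg, hτe⟩ := JET.exists_weilDatum_liftAut W τ (p ^ k) h2
  -- the intrinsic transverse family with its reconciliation (theorem)
  obtain ⟨𝒯, h𝒯, hT⟩ := JET.exists_localTransverseFamily W ι ((p ^ k : ℕ) : ℤ) hc0'
  -- the duality sign `−ε ∈ {±1}`
  have hs : -ε = 1 ∨ -ε = -1 := by
    rcases hε with rfl | rfl <;> simp
  -- the carrier pair is disjoint from the places dividing `c` (`c` is prime to the conductor)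
  have hcopN : Nat.Coprime c (W.conductorNorm ℤ) := by
    refine Nat.coprime_of_dvd fun q hq hqc hqN ↦ ?_
    exact (hcK q (Nat.mem_primeFactors.mpr ⟨hq, hqc, hc0'⟩)).1.2.1 hqN
  have hQc : Disjoint ({v₀, τ • v₀} : Finset (HeightOneSpectrum (𝓞 K))) (placesDividing K c) := by
    rw [Finset.disjoint_left]
    intro v hv hvc
    have hcv : (c : 𝓞 K) ∈ v.asIdeal := (mem_placesDividing_iff_natCast_mem hc0' v).mp hvc
    simp only [Finset.mem_insert, Finset.mem_singleton] at hv
    rcases hv with rfl | rfl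
    · exact Literature.NumberTheory.NumberFields.Honda1971.natCast_notMem_of_coprime hcopN _ hcv hv₀N
    · refine Literature.NumberTheory.NumberFields.Honda1971.natCast_notMem_of_coprime hcopN _ hcv ?_
      have := (HeightOneSpectrum.smul_mem_smul_asIdeal_iff τ v₀ ((W.conductorNorm ℤ : ℕ) : 𝓞 K)).mpr hv₀N
      rwa [JET.GlobalDuality.smul_natCast_ringOfIntegers] at this
  -- the two Poitou–Tate packages (road K pv-1, by name), stringent family with (δ) supplied
  obtain ⟨C', hC, hdual_q, hdual_ℓ⟩ := JET.GlobalDuality.exists_rowDuality_modified W τ p k wp hμ hadd₁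
    hadd₂ hgal halt hnondeg hτe hPT ι hτ2 hp2 hk 𝒯 (JET.stringentFamily W K hn) hc0' hT
    (JET.conjActPlace_mem_transverseFamily_forall W K hK ι τ hτ p k hp2 c hc hcK 𝒯 h𝒯)
    (fun inv hinv v hv ↦ h𝒯sd 𝒯 h𝒯 wp hμ hadd₁ hadd₂ hgal halt hnondeg inv hinv v hv)
    (JET.stringentFamily_le_kummer W K hn) v₀ hv₀ hQc
    (fun v w h _ x hx ↦ JET.conjActPlace_mem_stringentFamily W τ hn h hx)
    (JET.isAddCyclic_kummer_quotient_stringentFamily W K hn v₀)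
    (JET.relIndex_stringentFamily_eq_pow W K hp k hn v₀ hc0 htk.le) (W.conductorNorm ℤ) hv₀N hs
    (fun ℓ h1 h2 h3 v hv hfix ↦ hloc ℓ h1 h2 h3 v hv hfix (-ε) hs)
  -- Prop 4.9♯ at `cℓ` assembled from its local clauses (sign, Kummer off `cℓ`, stringent, transverse)
  have h49 : ∀ (ℓ : ℕ) (h1 : Zhang2014.IsKolyvaginPrime (W.conductorNorm ℤ) W K p ℓ)
      (h2 : k ≤ Zhang2014.kolyvaginIndex W p ℓ) (h3 : ℓ ∉ c.primeFactors)
      (v : HeightOneSpectrum (𝓞 K)), (ℓ : 𝓞 K) ∈ v.asIdeal →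
      κℓ ℓ h1 h2 h3 ∈ signPart W K τ ((p ^ k : ℕ) : ℤ) (-ε)
        (((selmerF0 W ((p ^ k : ℕ) : ℤ) 𝒯 (JET.stringentFamily W K hn) (placesDividing K c)
          {v₀, τ • v₀}).relaxedAt {v}).selmerGroup) := by
    intro ℓ h1 h2 h3 v hv
    have hl : ℓ.Prime := h1.1
    have hpf : (c * ℓ).primeFactors = c.primeFactors ∪ {ℓ} := by
      rw [Nat.primeFactors_mul hc0' hl.ne_zero, hl.primeFactors]
    refine JET.mem_signPart_relaxedAt_selmerF0 W τ _ (-ε) 𝒯 (JET.stringentFamily W K hn) hc0'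
      {v₀, τ • v₀} v _ (hκℓsign ℓ h1 h2 h3) ?_ (fun q hq _ ↦ h49str ℓ h1 h2 h3 q hq)
      (fun w hw _ _ ↦ by rw [h𝒯 w]; exact h49tr ℓ h1 h2 h3 w hw)
    intro w hwc hwv _
    refine hκℓkum ℓ h1 h2 h3 w fun l' hl' hP ↦ ?_
    rw [hpf, Finset.mem_union, Finset.mem_singleton] at hl'
    rcases hl' with h | rfl
    · exact hwc l' h hP
    · obtain ⟨q, rfl, hq⟩ := hP
      exact hwv (congrArg Sum.inr
        (JET.HeightOneSpectrum.eq_of_natCast_mem_of_isPrime_span h1.1 h1.2.2.2.2.1 hq hv))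
  -- assemble through the class-data row theorem (sibling file)
  exact tamagawaExponent_le_mInfty_of_classData W hcm K hK p hp2 htower ι τ hτ k _ mInf hk htk hik c hc
    hcore ε hε κ hκsel hκsign hκ0 hordκ 𝒯 (JET.stringentFamily W K hn) hT
    (JET.stringentFamily_le_kummer W K hn) {v₀, τ • v₀} hQc C' hC hdual_q κℓ h49 h47 hdual_ℓ

end Summit.BirchSwinnertonDyer.BirchSwinnertonDyer.Theorems.GenusKolyvagin.ClassData

end
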